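import Summits.CriticalPhenomena.PercolationContinuityZ3.Theses.PercBudgetLadder

/-!
# Route `PercBudgetLadder`, item `SufficesTarget` (stmt-CriticalPhenomena-5254) — "it suffices to show X"

`SufficesTarget` says: `CritAnnulusBlockedIO → BlockingVanishesOfTheta → PercolationContinuityZ3` with both
hypotheses inlined, i.e.

* (X) for some aspect ratio `l ≥ 2` and some `c > 0`, for infinitely many `n` the critical annulus
  `box 3 n → innerBoundary (box 3 (l n))` of `ℤ³` is blocked inside `box 3 (l n)` with
  `P_{p_c}`-probability `≥ c`;
* (zero–one law side) whenever `θ(p) > 0`, for every `l ≥ 2` the `P_p`-probability that the annulus is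
  blocked tends to `0` as `n → ∞`;

together give `θ(p_c) = 0` on `ℤ³`.

Proof (pure logic + order of limits, Grimmett 1999 §1.4 style): if `θ(p_c) ≠ 0` then `θ(p_c) > 0`
(`θ` is a probability, `measureReal_nonneg`), so by the second hypothesis at `p = p_c` the blocking
probability at aspect `l` tends to `0`, hence is eventually `< c`; this contradicts `c ≤ P(blocked)` for
infinitely many `n`.
-/

namespace Summit.CriticalPhenomena.PercolationContinuityZ3.Theorems

open Filter

/-- **Item `stmt-CriticalPhenomena-5254` (`PercBudgetLadder.SufficesTarget`), proved.**
If critical annuli of some fixed aspect ratio `l ≥ 2` are blocked with probability `≥ c > 0` for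
infinitely many `n`, and percolation (`θ(p) > 0`) forces the blocking probability of aspect-`l` annuli to
tend to `0`, then `θ_{ℤ³}(p_c) = 0` (`PercolationContinuityZ3`). Pure logic: `θ(p_c) ≠ 0 ⇒ θ(p_c) > 0`,
then the limit `0` is eventually below `c`, contradicting the i.o. lower bound. [folklore] -/
theorem sufficesTarget_proof :
    Summit.CriticalPhenomena.PercolationContinuityZ3.Theses.PercBudgetLadder.SufficesTarget := by
  unfold Summit.CriticalPhenomena.PercolationContinuityZ3.Theses.PercBudgetLadder.SufficesTarget
  intro hX hBV
  obtain ⟨l, c, hl, hc, hio⟩ := hX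
  -- `PercolationContinuityZ3` is `θ (zdGraph 3) 0 (p_c) = 0`; argue by contradiction.
  by_contra hne
  have h0 : 0 ≤ Literature.Probability.Percolation.theta
      (Literature.Probability.LatticeModels.zdGraph 3) 0
      (Literature.Probability.Percolation.criticalProbI 3) := by
    unfold Literature.Probability.Percolation.theta
    exact MeasureTheory.measureReal_nonneg
  have hpos : 0 < Literature.Probability.Percolation.theta
      (Literature.Probability.LatticeModels.zdGraph 3) 0
      (Literature.Probability.Percolation.criticalProbI 3) :=
    lt_of_le_of_ne h0 (fun h => hne h.symm)
  -- at `p = p_c`, aspect `l`: the blocking probability tends to `0`, so it is eventually `< c`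
  have hT := hBV (Literature.Probability.Percolation.criticalProbI 3) hpos l hl
  have hev := hT.eventually (gt_mem_nhds hc)
  obtain ⟨N, hN⟩ := Filter.eventually_atTop.mp hev
  -- but for some `n ≥ N` it is `≥ c`
  obtain ⟨n, hn, hbound⟩ := hio N
  exact absurd (hN n hn) (not_lt.mpr hbound)

end Summit.CriticalPhenomena.PercolationContinuityZ3.Theorems
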